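import Summits.HubbardSuperconductivity.HubbardSuperconductivity.Theorems.DeformationLadderLadderThesisRigidityReduction
import Summits.HubbardSuperconductivity.HubbardSuperconductivity.Theorems.DeformationLadderAssembly
import Summits.HubbardSuperconductivity.HubbardSuperconductivity.Theorems.CwThesis.Negative.FreeEndpointFermiStep
import Summits.HubbardSuperconductivity.HubbardSuperconductivity.Theses.TwistGap

/-!
# `LadderThesis` (stmt-HubbardSuperconductivity-1890) — the free point `U = 0` is excluded

Tightness lemmas for the crux `LadderThesis` of route `DeformationLadder` and for the two members of
its equivalence class (`LowEnergyRigidity`, stmt-1892; `TwistGap.TgThesis`, stmt-1508): the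
hypothesis `0 < U` is load-bearing — at `U = 0` the matrix of each statement fails for EVERY choice
of the remaining parameters (`δ ≥ -1`, `s, κ, λ, a, c > 0`, `L₀`). Mechanism: at `U = 0` every
`(2n, S^z=0)`-sector ground state `ψ` of the free torus has pair intensity `Re⟨ψ, Δ_dᴴΔ_d ψ⟩ ≤ 320 L²`
(sharp Fermi step; the tree's `CwThesis.Negative.free_pairIntensity_le`), and by the
Kaplan–Horsch–von der Linden comparison (`deformationLadder_everyGS_floor`) the LRO density of ANY
ground state of the PENALISED free model `H₀ + (s/L⁴)Δ_dᴴΔ_d` is at most that of `ψ`, i.e.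
`≤ 320/L² → 0`.

* `lro_penalised_le_at_free_point` — `LRO(φ) ≤ 320/L²` for every normalised sector ground state
  `φ` of `hubbardTorus 2 L 1 0 + (s/L⁴)Δ_dᴴΔ_d`, `s > 0`, `L ≥ 3`.
* `not_ladderThesisMatrix_at_free_point` — the matrix of `LadderThesis` with `U := 0` is false.
* `not_lowEnergyRigidityMatrix_at_free_point` — the matrix of `LowEnergyRigidity` with `U := 0` is
  false (via the landed `stiffnessImpliesPenalised_proof` and `penalisedGroundStateExists_proof`).
* `not_tgThesisMatrix_at_free_point` — the matrix of `TwistGap.TgThesis` with `U := 0` is false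
  (a free sector ground state has zero excess energy and LRO `≤ 320/L²`).

* `re_expect_pairPenalty_anti`, `ladderThesisMatrix_anti`, `ladderThesis_iff_allSmallPenalties` — the
  LRO of penalised ground states is antitone in the penalty strength `s` (slope monotonicity of the
  concave penalised energy), so the matrix of `LadderThesis` at `s` gives it at every `s' ∈ (0, s]`
  with the same `(a, L₀)`: the crux is equivalent to its all-small-penalties form.

These are the `_false_without_hU` facts a disprover of any of the three cruxes records, plus the
quantifier structure in `s`; nothing here refutes an item (each item quantifies `∃ U > 0`). Kaplan–Horsch–von der Linden, J. Phys. Soc. Jpn. 58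
(1989) 3894; folklore (aufbau / Fermi step of the free gas).
-/

noncomputable section

-- `dupNamespace`: the summit and the problem are both named `HubbardSuperconductivity` (layout D-0022)
set_option linter.dupNamespace false

namespace Summit.HubbardSuperconductivity.HubbardSuperconductivity.Theorems.DeformationLadder

open Matrix Literature.MathematicalPhysics.QuantumLattice Literature.Probability.LatticeModels
open Summit.HubbardSuperconductivity.HubbardSuperconductivity.Theses.DeformationLadder
open scoped ComplexOrder

/-- **At `U = 0` every ground state of the penalised free torus has LRO density `≤ 320/L²`.** For
`L ≥ 3`, `s > 0`, `n ≤ L²` and a normalised ground state `φ` of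
`hubbardTorus 2 L 1 0 + (s/L⁴)·Δ_dᴴΔ_d` in the sector `(2n, S^z=0)`:
`L⁻⁴ Re⟨φ, Δ_dᴴΔ_d φ⟩ ≤ 320/L²` (Kaplan–Horsch–von der Linden comparison with a free sector ground state
`ψ`, whose pair intensity is `≤ 320L²` by the sharp Fermi step). [cite: KaplanHorschVonDerLinden1989] -/
theorem lro_penalised_le_at_free_point (L : ℕ) [NeZero L] (hL : 3 ≤ L) {s : ℝ} (hs : 0 < s) {n : ℕ}
    (hn : n ≤ L ^ 2) {φ : Fock (Orb (FermionTorus 2 L))} (hφ1 : star φ ⬝ᵥ φ = 1)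
    (hφ : IsGroundStateInSector (hubbardTorus 2 L 1 0 + ((s / (L : ℝ) ^ 4 : ℝ) : ℂ) •
      ((pairField dWaveFormFactor L)ᴴ * pairField dWaveFormFactor L)) (2 * n) 0 φ) :
    (expect ((pairField dWaveFormFactor L)ᴴ * pairField dWaveFormFactor L) φ).re / (L : ℝ) ^ 4 ≤
      320 / (L : ℝ) ^ 2 := by
  obtain ⟨ψ, hψ1, hψ⟩ :=
    Summit.HubbardSuperconductivity.NoGo.exists_unit_groundStateInSector_hubbardTorus L 1 0 hn
  have hfloor := deformationLadder_everyGS_floor L 0 hs (2 * n) hφ1 hφ le_rfl hψ1 hψ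
  have hfree := Summit.HubbardSuperconductivity.CwThesis.Negative.free_pairIntensity_le hL n ψ hψ hψ1
  have hL0 : (0 : ℝ) < L := Nat.cast_pos.2 (Nat.pos_of_ne_zero (NeZero.ne L))
  have hL2 : (0 : ℝ) < (L : ℝ) ^ 2 := by positivity
  have hL4 : (0 : ℝ) < (L : ℝ) ^ 4 := by positivity
  rw [div_le_div_iff₀ hL4 hL2]
  have h1 : (expect ((pairField dWaveFormFactor L)ᴴ * pairField dWaveFormFactor L) φ).re ≤
      320 * (L : ℝ) ^ 2 := by
    have e : (expect ((pairField dWaveFormFactor L)ᴴ * pairField dWaveFormFactor L) φ).re /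
        (L : ℝ) ^ 4 * (L : ℝ) ^ 4 =
        (expect ((pairField dWaveFormFactor L)ᴴ * pairField dWaveFormFactor L) φ).re :=
      div_mul_cancel₀ _ hL4.ne'
    linarith
  calc (expect ((pairField dWaveFormFactor L)ᴴ * pairField dWaveFormFactor L) φ).re * (L : ℝ) ^ 2
      ≤ 320 * (L : ℝ) ^ 2 * (L : ℝ) ^ 2 := mul_le_mul_of_nonneg_right h1 hL2.le
    _ = 320 * (L : ℝ) ^ 4 := by ring

/-- A large even side: for `a > 0` and `L₀` there is an even `L ≥ max(L₀, 3)` with `320/L² < a`. [folklore] -/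
theorem exists_even_side_large {a : ℝ} (ha : 0 < a) (L₀ : ℕ) :
    ∃ L : ℕ, L₀ ≤ L ∧ 3 ≤ L ∧ Even L ∧ 320 / (L : ℝ) ^ 2 < a := by
  refine ⟨2 * (max (max L₀ 3) (⌈320 / a⌉₊ + 1)), ?_, ?_, even_two_mul _, ?_⟩
  · have := le_max_left (max L₀ 3) (⌈320 / a⌉₊ + 1)
    have := le_max_left L₀ 3
    omega
  · have := le_max_left (max L₀ 3) (⌈320 / a⌉₊ + 1)
    have := le_max_right L₀ 3
    omega
  · set m : ℕ := max (max L₀ 3) (⌈320 / a⌉₊ + 1) with hm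
    have hm1 : ((⌈320 / a⌉₊ + 1 : ℕ) : ℝ) ≤ m := by exact_mod_cast le_max_right _ _
    push_cast at hm1
    have hceil : 320 / a ≤ (⌈320 / a⌉₊ : ℝ) := Nat.le_ceil _
    have hmr : 320 / a + 1 ≤ (m : ℝ) := by linarith
    have hLr : 320 / a + 1 ≤ ((2 * m : ℕ) : ℝ) := by
      push_cast
      have : (0 : ℝ) ≤ m := Nat.cast_nonneg _
      linarith
    have hLpos : (0 : ℝ) < ((2 * m : ℕ) : ℝ) := by
      have : (0 : ℝ) < 320 / a + 1 := by positivity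
      linarith
    have hL1 : (1 : ℝ) ≤ ((2 * m : ℕ) : ℝ) := by
      have : (1 : ℕ) ≤ 2 * m := by omega
      exact_mod_cast this
    rw [div_lt_iff₀ (by positivity)]
    -- `320 < a L²`: `a L ≥ 320 + a > 320` and `L² ≥ L`
    have h1 : 320 < a * ((2 * m : ℕ) : ℝ) := by
      have := mul_le_mul_of_nonneg_left hLr ha.le
      have e : a * (320 / a + 1) = 320 + a := by field_simp
      linarith
    have h2 : a * ((2 * m : ℕ) : ℝ) ≤ a * ((2 * m : ℕ) : ℝ) ^ 2 := by
      apply mul_le_mul_of_nonneg_left _ ha.le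
      nlinarith
    linarith

/-- **The matrix of `LadderThesis` fails at the free point `U = 0`**, for every `δ ≥ -1`, `s > 0`,
`a > 0` and `L₀`: there is no way to have, at all large even `L`, a normalised sector ground state of
`hubbardTorus 2 L 1 0 + (s/L⁴)Δ_dᴴΔ_d` with LRO density `≥ a` (it is `≤ 320/L²`). The hypothesis
`0 < U` of the crux is load-bearing. [cite: KaplanHorschVonDerLinden1989] -/
theorem not_ladderThesisMatrix_at_free_point (δ : ℝ) (hδ : -1 ≤ δ) {s a : ℝ} (hs : 0 < s)
    (ha : 0 < a) (L₀ : ℕ) :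
    ¬ ∀ (L : ℕ) [NeZero L], L₀ ≤ L → Even L →
        ∃ φ : Fock (Orb (FermionTorus 2 L)), star φ ⬝ᵥ φ = 1 ∧
          IsGroundStateInSector (hubbardTorus 2 L 1 0 + ((s / (L : ℝ) ^ 4 : ℝ) : ℂ) •
            ((pairField dWaveFormFactor L)ᴴ * pairField dWaveFormFactor L))
            (2 * ⌊(1 - δ) * (L : ℝ) ^ 2 / 2⌋₊) 0 φ ∧
          a ≤ (expect ((pairField dWaveFormFactor L)ᴴ * pairField dWaveFormFactor L) φ).re /
            (L : ℝ) ^ 4 := by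
  intro h
  obtain ⟨L, hL₀, hL3, hE, hsmall⟩ := exists_even_side_large ha L₀
  haveI : NeZero L := ⟨by omega⟩
  obtain ⟨φ, hφ1, hφ, hφa⟩ := h L hL₀ hE
  have hn := Summit.HubbardSuperconductivity.NoGo.floor_pairNumber_le δ hδ L
  have hlro := lro_penalised_le_at_free_point L hL3 hs hn hφ1 hφ
  linarith

/-- **The matrix of `LowEnergyRigidity` fails at the free point `U = 0`**, for every `δ ≥ -1`,
`κ > 0`, `a > 0` and `L₀`: if every normalised `(N_L, S^z=0)`-sector state within energy `κ` of the
free sector energy had LRO density `≥ a` at all large even `L`, then (support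
`StiffnessImpliesPenalised`, `s = κ/64`) every ground state of the penalised free model would too,
contradicting `not_ladderThesisMatrix_at_free_point`. [cite: KaplanHorschVonDerLinden1989] -/
theorem not_lowEnergyRigidityMatrix_at_free_point (δ : ℝ) (hδ : -1 ≤ δ) {κ a : ℝ} (hκ : 0 < κ)
    (ha : 0 < a) (L₀ : ℕ) :
    ¬ ∀ (L : ℕ) [NeZero L], L₀ ≤ L → Even L →
        ∀ φ : Fock (Orb (FermionTorus 2 L)),
          φ ∈ szSector (2 * ⌊(1 - δ) * (L : ℝ) ^ 2 / 2⌋₊) 0 → star φ ⬝ᵥ φ = 1 →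
            (star φ ⬝ᵥ Matrix.mulVec (hubbardTorus 2 L 1 0) φ).re ≤
                (hubbardTorus 2 L 1 0).minEnergyOn (szSector (2 * ⌊(1 - δ) * (L : ℝ) ^ 2 / 2⌋₊) 0) + κ →
              a ≤ (expect ((pairField dWaveFormFactor L)ᴴ * pairField dWaveFormFactor L) φ).re /
                (L : ℝ) ^ 4 := by
  intro h
  apply not_ladderThesisMatrix_at_free_point δ hδ (s := κ / 64) (by positivity) ha L₀
  intro L _ hL hE
  have hrig := h L hL hE
  have hn := Summit.HubbardSuperconductivity.NoGo.floor_pairNumber_le δ hδ L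
  obtain ⟨φ, hφ1, hφ⟩ := penalisedGroundStateExists_proof L 0 (κ / 64 / (L : ℝ) ^ 4) _ hn
  exact ⟨φ, hφ1, hφ, stiffnessImpliesPenalised_proof L 0 κ a _ hκ hrig (κ / 64) ⟨by positivity, le_rfl⟩
    φ hφ1 hφ⟩

/-- **The matrix of `TwistGap.TgThesis` fails at the free point `U = 0`**, for every `δ ≥ -1`,
`λ > 0`, `c > 0` and `L₀`: a normalised free sector ground state `ψ` has zero excess energy and LRO
density `≤ 320/L² < c` at a large even side (`free_pairIntensity_le`). [folklore] -/
theorem not_tgThesisMatrix_at_free_point (δ : ℝ) (hδ : -1 ≤ δ) {lam c : ℝ} (_hlam : 0 < lam)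
    (hc : 0 < c) (L₀ : ℕ) :
    ¬ ∀ (L : ℕ) [NeZero L], L₀ ≤ L → Even L →
        ∀ φ : Fock (Orb (FermionTorus 2 L)),
          φ ∈ szSector (2 * ⌊(1 - δ) * (L : ℝ) ^ 2 / 2⌋₊) 0 → star φ ⬝ᵥ φ = 1 →
            c ≤ (expect ((pairField dWaveFormFactor L)ᴴ * pairField dWaveFormFactor L) φ).re /
                  (L : ℝ) ^ 4 +
                lam * ((expect (hubbardTorus 2 L 1 0) φ).re -
                  (hubbardTorus 2 L 1 0).minEnergyOn (szSector (2 * ⌊(1 - δ) * (L : ℝ) ^ 2 / 2⌋₊) 0)) := by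
  intro h
  obtain ⟨L, hL₀, hL3, hE, hsmall⟩ := exists_even_side_large hc L₀
  haveI : NeZero L := ⟨by omega⟩
  have hn := Summit.HubbardSuperconductivity.NoGo.floor_pairNumber_le δ hδ L
  obtain ⟨ψ, hψ1, hψ⟩ :=
    Summit.HubbardSuperconductivity.NoGo.exists_unit_groundStateInSector_hubbardTorus L 1 0 hn
  have key := h L hL₀ hE ψ hψ.1 hψ1
  -- zero excess energy of the sector ground state
  have hexc : (expect (hubbardTorus 2 L 1 0) ψ).re =
      (hubbardTorus 2 L 1 0).minEnergyOn (szSector (2 * ⌊(1 - δ) * (L : ℝ) ^ 2 / 2⌋₊) 0) := by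
    rw [expect, hψ.2.2, dotProduct_smul, hψ1, smul_eq_mul, mul_one, Complex.ofReal_re]
  rw [hexc, sub_self, mul_zero, add_zero] at key
  -- pair intensity of the free ground state
  have hfree := Summit.HubbardSuperconductivity.CwThesis.Negative.free_pairIntensity_le hL3 _ ψ hψ hψ1
  have hL0 : (0 : ℝ) < L := by exact_mod_cast (show 0 < L by omega)
  have hL2 : (0 : ℝ) < (L : ℝ) ^ 2 := by positivity
  have hL4 : (0 : ℝ) < (L : ℝ) ^ 4 := by positivity
  have hlro : (expect ((pairField dWaveFormFactor L)ᴴ * pairField dWaveFormFactor L) ψ).re /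
      (L : ℝ) ^ 4 ≤ 320 / (L : ℝ) ^ 2 := by
    rw [div_le_div_iff₀ hL4 hL2]
    calc (expect ((pairField dWaveFormFactor L)ᴴ * pairField dWaveFormFactor L) ψ).re * (L : ℝ) ^ 2
        ≤ 320 * (L : ℝ) ^ 2 * (L : ℝ) ^ 2 := mul_le_mul_of_nonneg_right hfree hL2.le
      _ = 320 * (L : ℝ) ^ 4 := by ring
  linarith

/-! ### Monotonicity in the penalty strength -/

/-- **The LRO of penalised ground states is antitone in the penalty strength** (slope monotonicity of
the concave penalised sector energy; the finite-`L` Kaplan–Horsch–von der Linden comparison between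
the penalties `s' < s`): for unit sector ground states `φ` of `H_L + (s/L⁴)Δ_dᴴΔ_d` and `φ'` of
`H_L + (s'/L⁴)Δ_dᴴΔ_d` in the same sector, `Re⟨φ, Δ_dᴴΔ_d φ⟩ ≤ Re⟨φ', Δ_dᴴΔ_d φ'⟩`.
[cite: KaplanHorschVonDerLinden1989] -/
theorem re_expect_pairPenalty_anti (L : ℕ) [NeZero L] (U : ℝ) {s s' : ℝ} (hss' : s' < s) (N : ℕ)
    {φ φ' : Fock (Orb (FermionTorus 2 L))} (hφ1 : star φ ⬝ᵥ φ = 1) (hφ'1 : star φ' ⬝ᵥ φ' = 1)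
    (hφ : IsGroundStateInSector (hubbardTorus 2 L 1 U + ((s / (L : ℝ) ^ 4 : ℝ) : ℂ) •
      ((pairField dWaveFormFactor L)ᴴ * pairField dWaveFormFactor L)) N 0 φ)
    (hφ' : IsGroundStateInSector (hubbardTorus 2 L 1 U + ((s' / (L : ℝ) ^ 4 : ℝ) : ℂ) •
      ((pairField dWaveFormFactor L)ᴴ * pairField dWaveFormFactor L)) N 0 φ') :
    (expect ((pairField dWaveFormFactor L)ᴴ * pairField dWaveFormFactor L) φ).re ≤
      (expect ((pairField dWaveFormFactor L)ᴴ * pairField dWaveFormFactor L) φ').re := by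
  set P := (pairField dWaveFormFactor L)ᴴ * pairField dWaveFormFactor L with hP
  set H₁ := hubbardTorus 2 L 1 U + ((s' / (L : ℝ) ^ 4 : ℝ) : ℂ) • P with hH₁
  have hL0 : (0 : ℝ) < L := Nat.cast_pos.2 (Nat.pos_of_ne_zero (NeZero.ne L))
  have hL4 : (0 : ℝ) < (L : ℝ) ^ 4 := by positivity
  have hc : 0 < (s - s') / (L : ℝ) ^ 4 := div_pos (sub_pos.2 hss') hL4
  have e : hubbardTorus 2 L 1 U + ((s / (L : ℝ) ^ 4 : ℝ) : ℂ) • P =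
      H₁ + (((s - s') / (L : ℝ) ^ 4 : ℝ) : ℂ) • P := by
    rw [hH₁, add_assoc, ← add_smul]
    congr 2
    push_cast
    ring
  have hH₁h : H₁.IsHermitian := isHermitian_penalised L U (s' / (L : ℝ) ^ 4)
  have hPh : P.IsHermitian := isHermitian_conjTranspose_mul_self _
  rw [e] at hφ
  exact re_penalty_le_of_sector_groundStates hH₁h hPh hc (szSector N 0) hφ.1 hφ'.1 hφ.2.2 hφ'.2.2
    hφ1 hφ'1

/-- **The matrix of `LadderThesis` is antitone in the penalty strength**: if it holds with
`(U, δ, s, a, L₀)` then it holds with `(U, δ, s', a, L₀)` for every `s' ≤ s` (a penalised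
ground state at the weaker penalty exists by `penalisedGroundStateExists_proof` and has at least the
LRO of the one at the stronger penalty, `re_expect_pairPenalty_anti`). So in the crux the prover may
take `s` as small as convenient, and a disprover must exclude ALL small `s`.
[cite: KaplanHorschVonDerLinden1989] -/
theorem ladderThesisMatrix_anti (U δ : ℝ) (hδ : -1 ≤ δ) {s s' a : ℝ} (hss' : s' ≤ s) (L₀ : ℕ)
    (h : ∀ (L : ℕ) [NeZero L], L₀ ≤ L → Even L →
        ∃ φ : Fock (Orb (FermionTorus 2 L)), star φ ⬝ᵥ φ = 1 ∧
          IsGroundStateInSector (hubbardTorus 2 L 1 U + ((s / (L : ℝ) ^ 4 : ℝ) : ℂ) •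
            ((pairField dWaveFormFactor L)ᴴ * pairField dWaveFormFactor L))
            (2 * ⌊(1 - δ) * (L : ℝ) ^ 2 / 2⌋₊) 0 φ ∧
          a ≤ (expect ((pairField dWaveFormFactor L)ᴴ * pairField dWaveFormFactor L) φ).re /
            (L : ℝ) ^ 4) :
    ∀ (L : ℕ) [NeZero L], L₀ ≤ L → Even L →
        ∃ φ : Fock (Orb (FermionTorus 2 L)), star φ ⬝ᵥ φ = 1 ∧
          IsGroundStateInSector (hubbardTorus 2 L 1 U + ((s' / (L : ℝ) ^ 4 : ℝ) : ℂ) •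
            ((pairField dWaveFormFactor L)ᴴ * pairField dWaveFormFactor L))
            (2 * ⌊(1 - δ) * (L : ℝ) ^ 2 / 2⌋₊) 0 φ ∧
          a ≤ (expect ((pairField dWaveFormFactor L)ᴴ * pairField dWaveFormFactor L) φ).re /
            (L : ℝ) ^ 4 := by
  intro L _ hL hE
  obtain ⟨φ, hφ1, hφ, hφa⟩ := h L hL hE
  rcases hss'.eq_or_lt with heq | hlt
  · subst heq
    exact ⟨φ, hφ1, hφ, hφa⟩
  · have hn := Summit.HubbardSuperconductivity.NoGo.floor_pairNumber_le δ hδ L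
    obtain ⟨φ', hφ'1, hφ'⟩ := penalisedGroundStateExists_proof L U (s' / (L : ℝ) ^ 4) _ hn
    refine ⟨φ', hφ'1, hφ', hφa.trans ?_⟩
    exact div_le_div_of_nonneg_right (re_expect_pairPenalty_anti L U hlt _ hφ1 hφ'1 hφ hφ')
      (by positivity)

/-- **`LadderThesis` ↔ its all-small-penalties form**: `X` holds iff for some `U > 0`,
`δ ∈ (0,1/2)`, `a > 0` and `s₀ > 0`, for EVERY `s ∈ (0, s₀]` some normalised sector ground state of
`H_L + (s/L⁴)Δ_dᴴΔ_d` has LRO density `≥ a` at all large even `L` (with one `L₀` for all these `s`).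
[cite: KaplanHorschVonDerLinden1989] -/
theorem ladderThesis_iff_allSmallPenalties :
    LadderThesis ↔
      ∃ U : ℝ, 0 < U ∧ ∃ δ ∈ Set.Ioo (0:ℝ) (1 / 2), ∃ a : ℝ, 0 < a ∧ ∃ s₀ : ℝ, 0 < s₀ ∧ ∃ L₀ : ℕ,
        ∀ s ∈ Set.Ioc (0:ℝ) s₀, ∀ (L : ℕ) [NeZero L], L₀ ≤ L → Even L →
          ∃ φ : Fock (Orb (FermionTorus 2 L)), star φ ⬝ᵥ φ = 1 ∧
            IsGroundStateInSector (hubbardTorus 2 L 1 U + ((s / (L : ℝ) ^ 4 : ℝ) : ℂ) •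
              ((pairField dWaveFormFactor L)ᴴ * pairField dWaveFormFactor L))
              (2 * ⌊(1 - δ) * (L : ℝ) ^ 2 / 2⌋₊) 0 φ ∧
            a ≤ (expect ((pairField dWaveFormFactor L)ᴴ * pairField dWaveFormFactor L) φ).re /
              (L : ℝ) ^ 4 := by
  constructor
  · rintro ⟨U, hU, δ, hδ, s, hs, a, ha, L₀, h⟩
    refine ⟨U, hU, δ, hδ, a, ha, s, hs, L₀, fun s' hs' => ?_⟩
    exact ladderThesisMatrix_anti U δ (by linarith [hδ.1]) hs'.2 L₀ h
  · rintro ⟨U, hU, δ, hδ, a, ha, s₀, hs₀, L₀, h⟩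
    exact ⟨U, hU, δ, hδ, s₀, hs₀, a, ha, L₀, h s₀ ⟨hs₀, le_rfl⟩⟩

end Summit.HubbardSuperconductivity.HubbardSuperconductivity.Theorems.DeformationLadder

end
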